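import Literature.NumberTheory.Sieve.HeathBrownCubicSiegelWalfisz
import Literature.NumberTheory.Sieve.HeathBrownCubicFLChains
import HarnessLib

/-!
# The Möbius function on the ideals of `ℤ[2^{1/3}]`: multiplicativity, `∑_{I ∣ 𝔟} μ(I) = [𝔟 = 1]`, and the (8.7) identity

Tool file (proofs only, no definitions, no named facts) in the decomposition of **parity.S18**
(`Literature.NumberTheory.Sieve.setOf_prime_cube_add_two_mul_cube_infinite`) along D. R. Heath-Brown,
*Primes represented by `x³ + 2y³`*, Acta Math. 186 (2001), 1–84. The Möbius function `μ(J)` on the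
integral ideals of `K = ℚ(2^{1/3})` enters the leading part `e_S` of the Type II weights ((3.12),
`idealMoebius` of `HeathBrownCubicTypeII`: `(−1)^{ω(J)}` on square-free `J`, `0` otherwise), and the
evaluation of the main term of Lemma 8.1 (p. 51: "Using multiplicativity, the main term is readily
evaluated as `γ₀⁻¹N(q)/φ_K(q)` if `q` and `α` are coprime, and zero otherwise") rests on the standard
algebra of `μ` PROVED here:

* `idealMoebius_of_squarefree`, `idealMoebius_of_not_squarefree`, `idealMoebius_bot`, `idealMoebius_top`;
* **`idealMoebius_mul_of_coprime`** (`μ(IA) = μ(I)μ(A)` for `I + A = (1)`),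
  `idealMoebius_mul_of_not_coprime` (`μ(IA) = 0` otherwise), via `isRelPrime_iff_sup_eq_top`,
  Mathlib's `squarefree_mul_iff` and `primeFactorsFinset_mul_of_coprime`;
* **`sum_idealDivisors_idealMoebius`** — `∑_{I ∣ 𝔟} μ(I) = [𝔟 = (1)]` for `𝔟 ≠ 0`: the square-free
  divisors of `𝔟` are the products of the subsets of its prime factors
  (`prod_primeFactorsFinset_of_squarefree`, `primeFactorsFinset_prod_eq` of `HeathBrownCubicFLChains`,
  `squarefree_prod_of_isPrime`)
  and `∑_{T ⊆ S} (−1)^{#T} = [S = ∅]` (Mathlib's `Finset.sum_powerset_neg_one_pow_card`);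
* `sum_filter_mem_idealMoebius` — `∑_{I ∣ 𝔮, α ∈ I} μ(I) = [𝔮 + (α) = (1)]`, and `coprimeInd_eq_ite_sup` —
  this indicator for `𝔮 = (q)` is Heath-Brown's `ε(α, q)` (`coprimeInd` of `HeathBrownCubicSiegelWalfisz`);
* `absNorm_inf_mul_absNorm_sup` — `N(J ∩ 𝔮)N(J + 𝔮) = N(J)N(𝔮)` (`N([J, q]) = N(J)N(q)/N((J, q))`,
  Mathlib's `Ideal.sup_mul_inf`);
* `idealMoebius_mul_ite_eq` — the pointwise identity behind the substitution `J = IA`, `I = (J, q)` of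
  (8.7): for `I ∣ 𝔮`, `μ(IA)·[A ≠ 0 ∧ IA + 𝔮 = I] = μ(I)μ(A)·[A + 𝔮 = (1)]`.

## References

* D. R. Heath-Brown, *Primes represented by `x³ + 2y³`*, Acta Math. 186 (2001), 1–84: (3.12) p. 18,
  (8.7) p. 50 and p. 51. [cite: HeathBrownActa2001, §8 (8.7)]

## Mathlib / tree search

Mathlib: `squarefree_mul_iff` (`DecompositionMonoid`, which `Ideal (𝓞 K)` is as a unique factorisation
monoid), `Ideal.prime_of_isPrime`, `Prime.squarefree`, `UniqueFactorizationMonoid.squarefree_iff_nodup_normalizedFactors`,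
`Ideal.prod_normalizedFactors_eq_self`, `Ideal.mem_normalizedFactors_iff`, `Multiset.toFinset_prod_dvd_prod`,
`Finset.sum_powerset_neg_one_pow_card`, `Ideal.sup_mul_inf`, `Ideal.mul_sup`, `mul_left_cancel₀` (ideals of
a Dedekind domain), `IsCoprime.mul_right`, `Ideal.isCoprime_iff_sup_eq`, `Ideal.isCoprime_span_singleton_iff`.
Mathlib's `ArithmeticFunction.moebius` is on `ℕ` only. Tree: `HeathBrownCubicTypeII` (`idealMoebius`,
`idealDivisors`, `mem_idealDivisors_iff`), `HeathBrownCubicSieveSetup` (`primeFactorsFinset`,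
`mem_primeFactorsFinset_iff`, `ne_bot_of_mem_primeFactorsFinset`), `HeathBrownCubicSiegelWalfisz`
(`coprimeInd`), `HeathBrownCubicFLChains` (`primeFactorsFinset_prod_eq`).
-/

noncomputable section

open Polynomial NumberField Finset

namespace Literature.NumberTheory.Sieve.CubicSieve

open LFunctions.CubeRootTwoField CubicPrimes

/-! ### The Möbius function on ideals: values, multiplicativity, inversion -/

section Moebius

/-- Relatively prime ideals of `𝓞_K` are the comaximal ones. [folklore] -/
theorem isRelPrime_iff_sup_eq_top {I J : Ideal (𝓞 K)} : IsRelPrime I J ↔ I ⊔ J = ⊤ := by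
  constructor
  · intro h
    have hd : I ⊔ J ∣ I := Ideal.dvd_iff_le.mpr le_sup_left
    have hd' : I ⊔ J ∣ J := Ideal.dvd_iff_le.mpr le_sup_right
    exact Ideal.isUnit_iff.mp (h hd hd')
  · intro h d hdI hdJ
    rw [Ideal.isUnit_iff, eq_top_iff, ← h]
    exact sup_le (Ideal.le_of_dvd hdI) (Ideal.le_of_dvd hdJ)

/-- `μ(J) = (−1)^{ω(J)}` for square-free `J`. [cite: HeathBrownActa2001, §3 (3.12)] -/
theorem idealMoebius_of_squarefree {J : Ideal (𝓞 K)} (h : Squarefree J) :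
    idealMoebius J = (-1) ^ (primeFactorsFinset J).card := by
  classical
  exact if_pos h

/-- `μ(J) = 0` for `J` not square-free. [cite: HeathBrownActa2001, §3 (3.12)] -/
theorem idealMoebius_of_not_squarefree {J : Ideal (𝓞 K)} (h : ¬Squarefree J) : idealMoebius J = 0 := by
  classical
  exact if_neg h

/-- `μ(0) = 0`. [folklore] -/
theorem idealMoebius_bot : idealMoebius (⊥ : Ideal (𝓞 K)) = 0 :=
  idealMoebius_of_not_squarefree (by rw [← Ideal.zero_eq_bot]; exact not_squarefree_zero)

/-- The unit ideal has no prime ideal factors. [folklore] -/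
theorem primeFactorsFinset_top : primeFactorsFinset (⊤ : Ideal (𝓞 K)) = ∅ := by
  classical
  rw [Finset.eq_empty_iff_forall_notMem]
  intro P hP
  obtain ⟨hPp, hPd⟩ := (mem_primeFactorsFinset_iff (I := ⊤) top_ne_bot).mp hP
  exact hPp.ne_top (top_le_iff.mp (Ideal.le_of_dvd hPd))

/-- `μ(1) = 1`. [folklore] -/
theorem idealMoebius_top : idealMoebius (⊤ : Ideal (𝓞 K)) = 1 := by
  rw [idealMoebius_of_squarefree (by rw [← Ideal.one_eq_top]; exact squarefree_one), primeFactorsFinset_top,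
    Finset.card_empty, pow_zero]

/-- The prime ideal factors of a product of coprime non-zero ideals. [folklore] -/
theorem primeFactorsFinset_mul_of_coprime {I A : Ideal (𝓞 K)} (hI : I ≠ ⊥) (hA : A ≠ ⊥) (h : I ⊔ A = ⊤) :
    primeFactorsFinset (I * A) = primeFactorsFinset I ∪ primeFactorsFinset A ∧
      Disjoint (primeFactorsFinset I) (primeFactorsFinset A) := by
  have hIA : I * A ≠ ⊥ := mul_ne_zero hI hA
  constructor
  · ext P
    rw [Finset.mem_union, mem_primeFactorsFinset_iff hIA, mem_primeFactorsFinset_iff hI,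
      mem_primeFactorsFinset_iff hA]
    constructor
    · rintro ⟨hP, hPd⟩
      rcases hP.mul_le.mp (Ideal.le_of_dvd hPd) with h1 | h2
      · exact Or.inl ⟨hP, Ideal.dvd_iff_le.mpr h1⟩
      · exact Or.inr ⟨hP, Ideal.dvd_iff_le.mpr h2⟩
    · rintro (⟨hP, hPd⟩ | ⟨hP, hPd⟩)
      · exact ⟨hP, hPd.mul_right _⟩
      · exact ⟨hP, hPd.mul_left _⟩
  · rw [Finset.disjoint_left]
    intro P hPI hPA
    obtain ⟨hP, hdI⟩ := (mem_primeFactorsFinset_iff hI).mp hPI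
    obtain ⟨-, hdA⟩ := (mem_primeFactorsFinset_iff hA).mp hPA
    have : I ⊔ A ≤ P := sup_le (Ideal.le_of_dvd hdI) (Ideal.le_of_dvd hdA)
    rw [h, top_le_iff] at this
    exact hP.ne_top this

/-- **Multiplicativity of `μ` on coprime ideals**: `μ(IA) = μ(I)μ(A)` for `I + A = (1)`. [folklore] -/
theorem idealMoebius_mul_of_coprime {I A : Ideal (𝓞 K)} (h : I ⊔ A = ⊤) :
    idealMoebius (I * A) = idealMoebius I * idealMoebius A := by
  by_cases hI : I = ⊥
  · rw [hI, Ideal.bot_mul, idealMoebius_bot, zero_mul]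
  by_cases hA : A = ⊥
  · rw [hA, Ideal.mul_bot, idealMoebius_bot, mul_zero]
  have hrel : IsRelPrime I A := isRelPrime_iff_sup_eq_top.mpr h
  by_cases hsI : Squarefree I
  · by_cases hsA : Squarefree A
    · have hsIA : Squarefree (I * A) := squarefree_mul_iff.mpr ⟨hrel, hsI, hsA⟩
      obtain ⟨hunion, hdisj⟩ := primeFactorsFinset_mul_of_coprime hI hA h
      rw [idealMoebius_of_squarefree hsIA, idealMoebius_of_squarefree hsI, idealMoebius_of_squarefree hsA,
        hunion, Finset.card_union_of_disjoint hdisj, pow_add]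
    · have : ¬Squarefree (I * A) := fun h' => hsA (squarefree_mul_iff.mp h').2.2
      rw [idealMoebius_of_not_squarefree this, idealMoebius_of_not_squarefree hsA, mul_zero]
  · have : ¬Squarefree (I * A) := fun h' => hsI (squarefree_mul_iff.mp h').2.1
    rw [idealMoebius_of_not_squarefree this, idealMoebius_of_not_squarefree hsI, zero_mul]

/-- `μ(IA) = 0` when `I`, `A` are not coprime (then `IA` is not square-free). [folklore] -/
theorem idealMoebius_mul_of_not_coprime {I A : Ideal (𝓞 K)} (h : I ⊔ A ≠ ⊤) : idealMoebius (I * A) = 0 :=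
  idealMoebius_of_not_squarefree fun h' => h (isRelPrime_iff_sup_eq_top.mp (squarefree_mul_iff.mp h').1)

/-- The prime ideal factors of a non-zero ideal are Mathlib's normalised prime factors. [folklore] -/
theorem primeFactorsFinset_eq_toFinset {I : Ideal (𝓞 K)} (hI : I ≠ ⊥) :
    primeFactorsFinset I = (UniqueFactorizationMonoid.normalizedFactors I).toFinset := by
  classical
  ext P
  rw [mem_primeFactorsFinset_iff hI, Multiset.mem_toFinset, Ideal.mem_normalizedFactors_iff hI,
    Ideal.dvd_iff_le]

/-- **A square-free ideal is the product of its prime ideal factors.** [folklore] -/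
theorem prod_primeFactorsFinset_of_squarefree {I : Ideal (𝓞 K)} (hI : Squarefree I) :
    ∏ P ∈ primeFactorsFinset I, P = I := by
  classical
  have h0 : I ≠ ⊥ := by rw [← Ideal.zero_eq_bot]; exact hI.ne_zero
  have hnodup : (UniqueFactorizationMonoid.normalizedFactors I).Nodup :=
    (UniqueFactorizationMonoid.squarefree_iff_nodup_normalizedFactors h0).mp hI
  rw [primeFactorsFinset_eq_toFinset h0, ← Multiset.toFinset_eq hnodup, Finset.prod_mk, Multiset.map_id',
    Ideal.prod_normalizedFactors_eq_self h0]

/-- The product of the distinct prime factors of `𝔟 ≠ 0` divides `𝔟`. [folklore] -/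
theorem prod_primeFactorsFinset_dvd {𝔟 : Ideal (𝓞 K)} (h𝔟 : 𝔟 ≠ ⊥) : ∏ P ∈ primeFactorsFinset 𝔟, P ∣ 𝔟 := by
  classical
  have h := Multiset.toFinset_prod_dvd_prod (UniqueFactorizationMonoid.normalizedFactors 𝔟)
  rw [Ideal.prod_normalizedFactors_eq_self h𝔟, ← primeFactorsFinset_eq_toFinset h𝔟] at h
  simpa using h

/-- A product of distinct non-zero prime ideals is square-free. [folklore] -/
theorem squarefree_prod_of_isPrime {s : Finset (Ideal (𝓞 K))} (hs : ∀ P ∈ s, P.IsPrime ∧ P ≠ ⊥) :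
    Squarefree (∏ P ∈ s, P) := by
  classical
  induction s using Finset.induction_on with
  | empty => rw [Finset.prod_empty, Ideal.one_eq_top, ← Ideal.one_eq_top]; exact squarefree_one
  | insert P t hPt ih =>
    have ht : ∀ Q ∈ t, Q.IsPrime ∧ Q ≠ ⊥ := fun Q hQ => hs Q (Finset.mem_insert_of_mem hQ)
    obtain ⟨hP, hP0⟩ := hs P (Finset.mem_insert_self P t)
    rw [Finset.prod_insert hPt, squarefree_mul_iff]
    refine ⟨?_, (Ideal.prime_of_isPrime hP0 hP).squarefree, ih ht⟩
    rw [isRelPrime_iff_sup_eq_top]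
    -- `∏ t ⊄ P` as `P ∉ t`
    have hnot : ¬(∏ Q ∈ t, Q ≤ P) := by
      intro hle
      obtain ⟨Q, hQ, hQP⟩ := (hP.prod_le).mp hle
      have := ((ht Q hQ).1.isMaximal (ht Q hQ).2).eq_of_le hP.ne_top hQP
      exact hPt (this ▸ hQ)
    exact (hP.isMaximal hP0).out.2 _ (left_lt_sup.mpr hnot)

/-- `𝔟 ≠ 0` has no prime ideal factors iff `𝔟 = (1)`. [folklore] -/
theorem primeFactorsFinset_eq_empty_iff {𝔟 : Ideal (𝓞 K)} (h𝔟 : 𝔟 ≠ ⊥) : primeFactorsFinset 𝔟 = ∅ ↔ 𝔟 = ⊤ := by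
  constructor
  · intro h
    by_contra hne
    obtain ⟨P, hPmax, hle⟩ := Ideal.exists_le_maximal 𝔟 hne
    have hP : P ∈ primeFactorsFinset 𝔟 :=
      (mem_primeFactorsFinset_iff h𝔟).mpr ⟨hPmax.isPrime, Ideal.dvd_iff_le.mpr hle⟩
    rw [h] at hP
    exact Finset.notMem_empty P hP
  · rintro rfl; exact primeFactorsFinset_top

open scoped Classical in
/-- **Möbius inversion over the ideals: `∑_{I ∣ 𝔟} μ(I) = [𝔟 = (1)]`** for `𝔟 ≠ 0` (the square-free
divisors of `𝔟` are the products of subsets of its prime factors, and `∑_{T ⊆ S} (−1)^{#T} = [S = ∅]`).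
[folklore] -/
theorem sum_idealDivisors_idealMoebius {𝔟 : Ideal (𝓞 K)} (h𝔟 : 𝔟 ≠ ⊥) :
    ∑ I ∈ idealDivisors 𝔟, idealMoebius I = if 𝔟 = ⊤ then 1 else 0 := by
  -- restrict to square-free divisors
  have h1 : ∑ I ∈ idealDivisors 𝔟, idealMoebius I =
      ∑ I ∈ (idealDivisors 𝔟).filter Squarefree, (-1 : ℝ) ^ (primeFactorsFinset I).card := by
    rw [Finset.sum_filter]
    refine Finset.sum_congr rfl fun I _ => ?_
    split_ifs with h
    · exact idealMoebius_of_squarefree h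
    · exact idealMoebius_of_not_squarefree h
  -- the square-free divisors are the products of sets of prime factors of `𝔟`
  have hpf : ∀ P ∈ primeFactorsFinset 𝔟, P.IsPrime ∧ P ≠ ⊥ := fun P hP =>
    ⟨((mem_primeFactorsFinset_iff h𝔟).mp hP).1, ne_bot_of_mem_primeFactorsFinset h𝔟 hP⟩
  have h2 : ∑ I ∈ (idealDivisors 𝔟).filter Squarefree, (-1 : ℝ) ^ (primeFactorsFinset I).card =
      ∑ T ∈ (primeFactorsFinset 𝔟).powerset, (-1 : ℝ) ^ T.card := by
    refine Finset.sum_nbij' (fun I => primeFactorsFinset I) (fun T => ∏ P ∈ T, P) ?_ ?_ ?_ ?_ ?_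
    · intro I hI
      rw [Finset.mem_filter, mem_idealDivisors_iff h𝔟] at hI
      obtain ⟨hId, hIsq⟩ := hI
      have hI0 : I ≠ ⊥ := by rw [← Ideal.zero_eq_bot]; exact hIsq.ne_zero
      rw [Finset.mem_powerset]
      intro P hP
      obtain ⟨hPp, hPI⟩ := (mem_primeFactorsFinset_iff hI0).mp hP
      exact (mem_primeFactorsFinset_iff h𝔟).mpr ⟨hPp, hPI.trans hId⟩
    · intro T hT
      rw [Finset.mem_powerset] at hT
      have hT' : ∀ P ∈ T, P.IsPrime ∧ P ≠ ⊥ := fun P hP => hpf P (hT hP)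
      rw [Finset.mem_filter, mem_idealDivisors_iff h𝔟]
      exact ⟨(Finset.prod_dvd_prod_of_subset _ _ _ hT).trans (prod_primeFactorsFinset_dvd h𝔟),
        squarefree_prod_of_isPrime hT'⟩
    · intro I hI
      rw [Finset.mem_filter] at hI
      exact prod_primeFactorsFinset_of_squarefree hI.2
    · intro T hT
      rw [Finset.mem_powerset] at hT
      exact primeFactorsFinset_prod_eq fun P hP => hpf P (hT hP)
    · intro I _
      rfl
  have h3 : ∑ T ∈ (primeFactorsFinset 𝔟).powerset, (-1 : ℝ) ^ T.card =
      if primeFactorsFinset 𝔟 = ∅ then 1 else 0 := by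
    have := Finset.sum_powerset_neg_one_pow_card (x := primeFactorsFinset 𝔟)
    have hcast : ((∑ T ∈ (primeFactorsFinset 𝔟).powerset, (-1 : ℤ) ^ T.card : ℤ) : ℝ) =
        ∑ T ∈ (primeFactorsFinset 𝔟).powerset, (-1 : ℝ) ^ T.card := by push_cast; rfl
    rw [← hcast, this]
    split_ifs <;> simp
  rw [h1, h2, h3]
  exact if_congr (primeFactorsFinset_eq_empty_iff h𝔟) rfl rfl

end Moebius

/-! ### Towards (8.7): `lcm · gcd`, `∑_{I ∣ 𝔮, α ∈ I} μ(I) = ε(α, q)`, and the substitution `J = IA` -/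

section MainTerm

/-- `N(I) > 0` for `I ≠ 0` (as a real number). [folklore] -/
theorem absNorm_cast_pos {I : Ideal (𝓞 K)} (hI : I ≠ ⊥) : (0 : ℝ) < Ideal.absNorm I := by
  exact_mod_cast Nat.pos_of_ne_zero fun h => hI (Ideal.absNorm_eq_zero_iff.mp h)

/-- **`lcm · gcd`: `N(J ∩ 𝔮) N(J + 𝔮) = N(J) N(𝔮)`** (Mathlib's `Ideal.sup_mul_inf`). [folklore] -/
theorem absNorm_inf_mul_absNorm_sup (J I : Ideal (𝓞 K)) :
    Ideal.absNorm (J ⊓ I) * Ideal.absNorm (J ⊔ I) = Ideal.absNorm J * Ideal.absNorm I := by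
  rw [mul_comm, ← map_mul, Ideal.sup_mul_inf, map_mul]

open scoped Classical in
/-- The divisors `I` of `𝔮 ≠ 0` with `α ∈ I` are the divisors of `𝔮 + (α)`, so that
**`∑_{I ∣ 𝔮, α ∈ I} μ(I) = [𝔮 + (α) = (1)]`**. [cite: HeathBrownActa2001, §8 p. 51] -/
theorem sum_filter_mem_idealMoebius {𝔮 : Ideal (𝓞 K)} (h𝔮 : 𝔮 ≠ ⊥) (α : 𝓞 K) :
    ∑ I ∈ (idealDivisors 𝔮).filter (fun I => α ∈ I), idealMoebius I =
      if 𝔮 ⊔ Ideal.span {α} = ⊤ then 1 else 0 := by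
  have h0 : 𝔮 ⊔ Ideal.span {α} ≠ ⊥ := fun h => h𝔮 (le_bot_iff.mp (le_sup_left.trans h.le))
  rw [← sum_idealDivisors_idealMoebius h0]
  refine Finset.sum_congr ?_ fun _ _ => rfl
  ext I
  rw [Finset.mem_filter, mem_idealDivisors_iff h𝔮, mem_idealDivisors_iff h0, Ideal.dvd_iff_le, Ideal.dvd_iff_le,
    sup_le_iff, Ideal.span_singleton_le_iff_mem]

/-- `ε(α, q) = [ (q) + (α) = (1) ]`. [cite: HeathBrownActa2001, Lemma 8.1] -/
theorem coprimeInd_eq_ite_sup (α : 𝓞 K) (q : ℕ) :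
    coprimeInd α q = if Ideal.span {(q : 𝓞 K)} ⊔ Ideal.span {α} = ⊤ then 1 else 0 := by
  classical
  unfold coprimeInd
  refine if_congr ?_ rfl rfl
  rw [← Ideal.isCoprime_span_singleton_iff, Ideal.isCoprime_iff_sup_eq, sup_comm]

/-- The key pointwise identity behind (8.7): for `I ∣ 𝔮`, `I ≠ 0` and any `A`,
`μ(IA) · [A ≠ 0 ∧ IA + 𝔮 = I] = μ(I)μ(A) · [A + 𝔮 = (1)]` (if `(I, A) ≠ 1` both vanish; if
`(I, A) = 1` then `μ(IA) = μ(I)μ(A)` and, writing `𝔮 = I𝔮'`, `IA + I𝔮' = I(A + 𝔮') = I` iff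
`A + 𝔮' = (1)` iff `A + 𝔮 = (1)`). [cite: HeathBrownActa2001, §8 (8.7)] -/
theorem idealMoebius_mul_ite_eq {I 𝔮 : Ideal (𝓞 K)} (hI : I ≠ ⊥) (hI𝔮 : I ∣ 𝔮) (A : Ideal (𝓞 K)) :
    (if A ≠ ⊥ ∧ I * A ⊔ 𝔮 = I then idealMoebius (I * A) else 0) =
      if A ⊔ 𝔮 = ⊤ then idealMoebius I * idealMoebius A else 0 := by
  obtain ⟨𝔮', h𝔮'⟩ := hI𝔮
  by_cases hA : A = ⊥
  · subst hA
    rw [if_neg (fun h => h.1 rfl)]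
    split_ifs
    · rw [idealMoebius_bot, mul_zero]
    · rfl
  by_cases hcop : I ⊔ A = ⊤
  · have hiff : (A ≠ ⊥ ∧ I * A ⊔ 𝔮 = I) ↔ A ⊔ 𝔮 = ⊤ := by
      rw [h𝔮', ← Ideal.mul_sup]
      constructor
      · rintro ⟨-, h⟩
        have h' : A ⊔ 𝔮' = ⊤ := by
          have : I * (A ⊔ 𝔮') = I * ⊤ := by rw [h, Ideal.mul_top]
          exact mul_left_cancel₀ hI this
        have h1 : IsCoprime A I := Ideal.isCoprime_iff_sup_eq.mpr (by rw [sup_comm]; exact hcop)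
        have h2 : IsCoprime A 𝔮' := Ideal.isCoprime_iff_sup_eq.mpr h'
        exact Ideal.isCoprime_iff_sup_eq.mp (h1.mul_right h2)
      · intro h
        refine ⟨hA, ?_⟩
        have h' : A ⊔ 𝔮' = ⊤ := by
          rw [eq_top_iff, ← h]
          exact sup_le le_sup_left (Ideal.mul_le_left.trans le_sup_right)
        rw [h', Ideal.mul_top]
    rw [idealMoebius_mul_of_coprime hcop]
    exact if_congr hiff rfl rfl
  · rw [idealMoebius_mul_of_not_coprime hcop]
    have hnot : ¬(A ⊔ 𝔮 = ⊤) := by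
      intro h
      apply hcop
      rw [eq_top_iff, ← h]
      exact sup_le le_sup_right ((Ideal.le_of_dvd ⟨𝔮', h𝔮'⟩).trans le_sup_left)
    rw [if_neg hnot]
    split_ifs <;> rfl

end MainTerm

end Literature.NumberTheory.Sieve.CubicSieve

end
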